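import Summits.ResolutionOfSingularities.ResolutionOfSingularities.Theses.HilbertSamuelElimination
import Literature.AlgebraicGeometry.Resolution.HilbertSamuelLowerBound

/-!
# `ModificationsResolve` (crux stmt-ResolutionOfSingularities-18507, route `HilbertSamuelElimination`):
# the clause (ME2) of its hypothesis `SigmaMaxModifications` is load-bearing
# (negative-side support, refuter cdisprove seat; this file does NOT refute the crux)

The crux is definitionally `E → S` (`E = SigmaMaxModifications`, `S` the summit), so no
`_false_without_` lemma can exist. Recorded here, sorry-free and definition-free (the weakened
hypothesis `E⁻` = `E` with the single conjunct (ME2) `∀ ν maximal in Σ_X, ν ∉ Σ_{X'}` deleted is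
written inline each time):

* `dense_compl_hsMaxLocus` — for a reduced, non-regular, locally Noetherian scheme `X` and
  `N ≥ dim X`, `X ∖ X_max` is dense (`X_max ⊆ X ∖ X_reg` by
  `Scheme.hsMaxLocus_subset_compl_regularLocus`, and `X_reg ⊇ genericPoints X` is dense,
  `Scheme.dense_regularLocus`). This is also the content of the lead's
  `stub_dense_compl_hsMaxLocus` (which assumes `LocallyOfFiniteType` over a field; only
  `IsLocallyNoetherian` is used).
* `sigmaMaxModifications_imp_without_ME2` — `E → E⁻` (sanity);
* `sigmaMaxModifications_without_ME2_holds` — `E⁻` is TRUE, witnessed by the IDENTITY of `X`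
  (proper, an isomorphism over every open, `H` constant along it; its dense-preimage clause is
  literally `Dense (X ∖ X_max)`, the inline `H` being `Scheme.hsFun` by `rfl`);
* `modificationsResolve_without_ME2_iff` — so the crux with (ME2) deleted from its hypothesis is
  EQUIVALENT to the summit.

Moral for provers of crux 3: (ME2) must be used (in the lead's line: `hME2` of
`Scheme.no_infinite_hsFun_tower_of_isExcellent`).
-/

noncomputable section

set_option linter.dupNamespace false

namespace Summit.ResolutionOfSingularities.ResolutionOfSingularities.Theorems.ModificationsResolve.Negative

open CategoryTheory AlgebraicGeometry TopologicalSpace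
open Literature.AlgebraicGeometry.Resolution Literature.RingTheory.HilbertSamuel
open Summit.ResolutionOfSingularities.ResolutionOfSingularities.Theses.HilbertSamuelElimination

/-- **`X ∖ X_max` is dense** for a reduced, non-regular, locally Noetherian scheme and
`N ≥ dim X` (`dim 𝒪_{X,x} ≤ dim X ≤ N` at every point, Stacks 02IZ, so
`Scheme.hsMaxLocus_subset_compl_regularLocus` applies; the regular locus is dense,
`Scheme.dense_regularLocus`). -/
theorem dense_compl_hsMaxLocus (X : Scheme.{0}) [IsLocallyNoetherian X] [IsReduced X]
    (hX : ¬ Scheme.IsRegular X) {N : ℕ} (hdim : topologicalKrullDim X ≤ (N : WithBot ℕ∞)) :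
    Dense (Scheme.hsMaxLocus X N)ᶜ := by
  have hd : ∀ x : X, ∃ d : ℕ, ringKrullDim (X.presheaf.stalk x) = d ∧ d ≤ N := by
    intro x
    obtain ⟨d, hd⟩ : ∃ d : ℕ, ringKrullDim (X.presheaf.stalk x) = d :=
      exists_nat_eq_of_ne_bot_of_ne_top ringKrullDim_ne_bot ringKrullDim_ne_top
    refine ⟨d, hd, ?_⟩
    have h1 : ringKrullDim (X.presheaf.stalk x) ≤ topologicalKrullDim X := by
      rw [AlgebraicGeometry.ringKrullDim_stalk_eq_coheight, topologicalKrullDim,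
        Order.krullDim_eq_of_orderIso (irreducibleSetEquivPoints (α := X))]
      exact Order.coheight_le_krullDim x
    have hle := h1.trans hdim
    rw [hd] at hle
    exact_mod_cast hle
  exact (Scheme.dense_regularLocus X).mono (Set.subset_compl_comm.mp
    (Scheme.hsMaxLocus_subset_compl_regularLocus hd hX))

/-- Sanity: `E⁻` (the conjunct (ME2) deleted) is a weakening of `SigmaMaxModifications`. -/
theorem sigmaMaxModifications_imp_without_ME2 (hE : SigmaMaxModifications) :
      ∀ p : ℕ, p.Prime → ∀ (k : Type) [Field k] [CharP k p] (X : AlgebraicGeometry.Scheme.{0}) (f : X ⟶ AlgebraicGeometry.Spec (.of k)), AlgebraicGeometry.IsSeparated f → AlgebraicGeometry.LocallyOfFiniteType f → AlgebraicGeometry.QuasiCompact f → AlgebraicGeometry.IsReduced X → ¬ Literature.AlgebraicGeometry.Resolution.Scheme.IsRegular X → ∀ N : ℕ, topologicalKrullDim X ≤ (N : WithBot ℕ∞) → let H : (Y : AlgebraicGeometry.Scheme.{0}) → Y → ℕ → ℕ := fun Y y => Literature.RingTheory.HilbertSamuel.hilbertSamuelFun (Y.presheaf.stalk y) (N - Literature.RingTheory.HilbertSamuel.minimalPrimesCodim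 (Y.presheaf.stalk y)); ∃ (X' : AlgebraicGeometry.Scheme.{0}) (π : X' ⟶ X), AlgebraicGeometry.IsProper π ∧ AlgebraicGeometry.IsReduced X' ∧ topologicalKrullDim X' ≤ (N : WithBot ℕ∞) ∧ (∀ U : X.Opens, (U : Set X) ⊆ {x | Maximal (· ∈ Set.range (H X)) (H X x)}ᶜ → CategoryTheory.IsIso (π ∣_ U)) ∧ Dense ((fun x' => π.base x') ⁻¹' {x | Maximal (· ∈ Set.range (H X)) (H X x)}ᶜ) ∧ (∀ x' : X', H X' x' ≤ H X (π.base x')) := by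
  intro p hp k _ _ X f hs hl hq hr hX N hN
  obtain ⟨X', π, h1, h2, h3, h4, h5, h6, -⟩ := hE p hp k X f hs hl hq hr hX N hN
  exact ⟨X', π, h1, h2, h3, h4, h5, h6⟩

/-- **Without (ME2), `SigmaMaxModifications` is trivially true**: the identity of `X` satisfies
every remaining clause (its dense-preimage clause being `dense_compl_hsMaxLocus`). -/
theorem sigmaMaxModifications_without_ME2_holds :
      ∀ p : ℕ, p.Prime → ∀ (k : Type) [Field k] [CharP k p] (X : AlgebraicGeometry.Scheme.{0}) (f : X ⟶ AlgebraicGeometry.Spec (.of k)), AlgebraicGeometry.IsSeparated f → AlgebraicGeometry.LocallyOfFiniteType f → AlgebraicGeometry.QuasiCompact f → AlgebraicGeometry.IsReduced X → ¬ Literature.AlgebraicGeometry.Resolution.Scheme.IsRegular X → ∀ N : ℕ, topologicalKrullDim X ≤ (N : WithBot ℕ∞) → let H : (Y : AlgebraicGeometry.Scheme.{0}) → Y → ℕ → ℕ := fun Y y => Literature.RingTheory.HilbertSamuel.hilbertSamuelFun (Y.presheaf.stalk y) (N - Literature.RingTheory.HilbertSamuel.minimalPrimesCodim (Y.presheaf.stalk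 y)); ∃ (X' : AlgebraicGeometry.Scheme.{0}) (π : X' ⟶ X), AlgebraicGeometry.IsProper π ∧ AlgebraicGeometry.IsReduced X' ∧ topologicalKrullDim X' ≤ (N : WithBot ℕ∞) ∧ (∀ U : X.Opens, (U : Set X) ⊆ {x | Maximal (· ∈ Set.range (H X)) (H X x)}ᶜ → CategoryTheory.IsIso (π ∣_ U)) ∧ Dense ((fun x' => π.base x') ⁻¹' {x | Maximal (· ∈ Set.range (H X)) (H X x)}ᶜ) ∧ (∀ x' : X', H X' x' ≤ H X (π.base x')) := by
  intro p hp k _ _ X f hs hl hq hr hX N hN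
  haveI : IsLocallyNoetherian X := LocallyOfFiniteType.isLocallyNoetherian f
  refine ⟨X, 𝟙 X, inferInstance, hr, hN, ?_, ?_, ?_⟩
  · intro U _; infer_instance
  · exact dense_compl_hsMaxLocus X hX hN
  · intro x; exact le_rfl

/-- **The crux with (ME2) deleted from its hypothesis is the summit itself.** -/
theorem modificationsResolve_without_ME2_iff :
    ((∀ p : ℕ, p.Prime → ∀ (k : Type) [Field k] [CharP k p] (X : AlgebraicGeometry.Scheme.{0}) (f : X ⟶ AlgebraicGeometry.Spec (.of k)), AlgebraicGeometry.IsSeparated f → AlgebraicGeometry.LocallyOfFiniteType f → AlgebraicGeometry.QuasiCompact f → AlgebraicGeometry.IsReduced X → ¬ Literature.AlgebraicGeometry.Resolution.Scheme.IsRegular X → ∀ N : ℕ, topologicalKrullDim X ≤ (N : WithBot ℕ∞) → let H : (Y : AlgebraicGeometry.Scheme.{0}) → Y → ℕ → ℕ := fun Y y => Literature.RingTheory.HilbertSamuel.hilbertSamuelFun (Y.presheaf.stalk y) (N - Literature.RingTheory.HilbertSamuel.minimalPrimesCodim (Y.presheaf.stalk y)); ∃ (X' : AlgebraicGeometry.Scheme.{0})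 (π : X' ⟶ X), AlgebraicGeometry.IsProper π ∧ AlgebraicGeometry.IsReduced X' ∧ topologicalKrullDim X' ≤ (N : WithBot ℕ∞) ∧ (∀ U : X.Opens, (U : Set X) ⊆ {x | Maximal (· ∈ Set.range (H X)) (H X x)}ᶜ → CategoryTheory.IsIso (π ∣_ U)) ∧ Dense ((fun x' => π.base x') ⁻¹' {x | Maximal (· ∈ Set.range (H X)) (H X x)}ᶜ) ∧ (∀ x' : X', H X' x' ≤ H X (π.base x'))) →
      ∀ p : ℕ, p.Prime → Literature.AlgebraicGeometry.Resolution.ResolutionInChar.{0} p) ↔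
    _root_.ResolutionOfSingularities :=
  ⟨fun h => h sigmaMaxModifications_without_ME2_holds, fun hS _ => hS⟩

end Summit.ResolutionOfSingularities.ResolutionOfSingularities.Theorems.ModificationsResolve.Negative

end
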